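import Summits.HodgeConjecture.HodgeConjecture.Theorems.F0P3cStCharTSStParahoricFixed   -- FILE A (this seat): H1 ∕ H2 ∕ H3@`K_v`
import HarnessLib

/-!
# F0 · P3c · line LH6 «StCharTS» — (G6)-ST HEAD @ `K_v`: `St_G(ψ)` HAS NO `K_v`-SPHERICAL VECTOR (RIDER 2b «EP-PAIRS», census EP-PAIRS v1 §3 (4); sequel of FILE A)

Cell `pub/hodgecm-mathlib` (D-0151), FLOOR 0, crux item H413 = `stmt-HodgeConjecture-24833` (`--supports` lane, helper; seat F0P3a-p06 (g25)).  THEOREMS ONLY; the ST-PIN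
letters (`ι`, `detZ`, `stG`, `detG` and their clauses, ★ `F0P3cStCharTSStPin.exists_stDetFields`) are READ as binders.  HONEST LABEL: count-neutral (RIDER 2b input: the `K_v`-term
of `Tr St_G(ψ)(f_EP^G)` vanishes; closes no node); HC_CM is proved only modulo the 7 printed citations (hLiu418 = stmt-HodgeConjecture-24832, h413 = stmt-HodgeConjecture-24833)
until rung 0 closes.

MATHEMATICS [Rogawski1990 §12.2 (1) p. 173, §12.6 p. 188; Borel 1976 §3–§4].  FILE A gives `dim St^{K_v} = dim i_G(χ_St(ψ∘ι))^{K_v} − [ψ∘detZ ≡ 1 on K_v]` (H1),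
`dim i_G(χ_St(ψ₀))^{K_v} = [ψ₀ = 1]` (H3) and `[ψ∘detZ ≡ 1 on K_v] = [ψ = 1]` (H2, `K_v ∋ d(1,b,1)`); since `ι` is onto `Z(G)` (★ ST-JH `surjective_of_pin`), `[ψ∘ι = 1] = [ψ = 1]`,
so `dim St_G(ψ)^{K_v} = 0` (`finrank_fixedPoints_st_integralLevel_eq_zero`), and `St_G(ψ)` being admissible (a constituent of the admissible `i_G(χ_St)`, ★
`isAdmissible_of_isConstituentOf`) the `K_v`-fixed space is `⊥` (**`st_fixedPoints_integralLevel_eq_bot`**) — «the Steinberg representation has no spherical vector».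

## References
* [Rogawski1990] J. D. Rogawski, *Automorphic Representations of Unitary Groups in Three Variables*, Ann. of Math. Stud. 123 (1990), §12.2 (1) pp. 172–173, §12.6 p. 188, §4.9 p. 54.
* [Borel1976] A. Borel, *Admissible representations of a semi-simple group over a local field with vectors fixed under an Iwahori subgroup*, Invent. Math. 35 (1976), §3–§4.
* [Casselman1995] W. Casselman, *Introduction to the theory of admissible representations of 𝔭-adic reductive groups* (notes, 1995), §2.1, §3.
-/

set_option autoImplicit false
-- the mandated namespace has the single-problem summit's repeated segment (`HodgeConjecture.HodgeConjecture`)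
set_option linter.dupNamespace false

noncomputable section

open NumberField IsDedekindDomain MeasureTheory
open scoped Matrix MatrixGroups NNReal
open Literature.NumberTheory.Automorphic Literature.NumberTheory.Automorphic.UnitaryGroup
open Literature.NumberTheory.Rogawski1990

namespace Summit.HodgeConjecture.HodgeConjecture.Cruxes.H413.F0P3cStCharTSStNoSpherical

open Summit.HodgeConjecture.HodgeConjecture.Cruxes.H413
open Summit.HodgeConjecture.HodgeConjecture.Cruxes.H413.F0P3cStCharTSStParahoricFixed
open Summit.HodgeConjecture.HodgeConjecture.Cruxes.H413.F0P3XiPacketFamilyOfRecord (isAdmissible_of_isConstituentOf)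

variable (L : Type) [Field L] [NumberField L] [IsCMField L] (v : HeightOneSpectrum (𝓞 ↥(maximalRealSubfield L)))

/-! ## The HEAD: rank zero, then `⊥` by admissibility -/

open Classical in
set_option maxHeartbeats 1600000 in
set_option synthInstance.maxHeartbeats 400000 in
-- instance-path unification between `Gqs L v` and the literal carrier of ★ `cmPrincipalSeries`
/-- **`dim St_G(ψ)^{K_v} = 0`** over the ST-PIN package (READ: `ι`, `detZ`, `stG`, `detG` with their clauses at the continuous `ψ`): by H1 at `K_v` with `χdet := ψ∘detZ`,
H3 at `ψ₀ := ψ∘ι` and H2 at `K_v`, `dim = [ψ∘ι = 1] − [ψ = 1]`, and `ψ∘ι = 1 ↔ ψ = 1` because `ι` is onto `Z(G)` (★ ST-JH `surjective_of_pin`).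
[cite: Rogawski1990, §12.2 (1) p. 173; §12.6 p. 188] [cite: Borel1976, §3–§4] -/
theorem finrank_fixedPoints_st_integralLevel_eq_zero (hns : ∀ w : PlacesOver L v, IsCMField.complexConj L • w.1 = w.1)
    (ι : ↥(normOneUnits (conjLocal L (IsCMField.complexConj L) v)) →* ↥(Subgroup.center (Gqs L v))) (hιc : Continuous ι)
    (hι : ∀ z : ↥(normOneUnits (conjLocal L (IsCMField.complexConj L) v)),
      ((ι z).val.val.val : Matrix (Fin 3) (Fin 3) (LocalRing L v)) = (((z : (LocalRing L v)ˣ) : LocalRing L v)) • (1 : Matrix (Fin 3) (Fin 3) (LocalRing L v)))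
    (detZ : Gqs L v →* ↥(Subgroup.center (Gqs L v)))
    (hdetZ : ∀ g : Gqs L v, ((detZ g).val.val.val : Matrix (Fin 3) (Fin 3) (LocalRing L v)) =
        (g.val.val : Matrix (Fin 3) (Fin 3) (LocalRing L v)).det • (1 : Matrix (Fin 3) (Fin 3) (LocalRing L v)))
    (stG detG : (↥(Subgroup.center (Gqs L v)) →* ℂˣ) → IrrClass (Gqs L v))
    (ψ : ↥(Subgroup.center (Gqs L v)) →* ℂˣ) (hψ : Continuous ψ)
    (hopen : IsOpen (((ψ.comp detZ).ker : Subgroup (Gqs L v)) : Set (Gqs L v)))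
    (hdet : detG ψ = IrrClass.mk (SmoothIrrep.ofChar (ψ.comp detZ) hopen))
    (hne : stG ψ ≠ detG ψ)
    (hJH : ∀ c : IrrClass (Gqs L v),
      c.IsConstituentOf (cmPrincipalSeries L 3 v
        (cmTorusCharPair L v (halfModulusChar (LocalRing L v) * halfModulusChar (LocalRing L v))⁻¹ (ψ.comp ι))) ↔ (c = stG ψ ∨ c = detG ψ))
    (r : SmoothIrrep (Gqs L v)) (hr : IrrClass.mk r = stG ψ) :
    Module.finrank ℂ (r.ρ.fixedPoints (cmLocalIntegralLevel L 3 (qsForm L) v)) = 0 := by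
  have hK := isCompact_isOpen_cmLocalIntegralLevel L 3 (qsForm L) v
  have hψι : Continuous fun x => (((ψ.comp ι) x : ℂˣ) : ℂ) := Units.continuous_val.comp (hψ.comp hιc)
  -- H1 at `K_v`
  have h1 := finrank_fixedPoints_st_eq_sub L v hns (ψ.comp ι) hψι hne hJH (ψ.comp detZ) hopen hdet r hr
    (cmLocalIntegralLevel L 3 (qsForm L) v) hK.2 hK.1
  -- H3 at `ψ₀ := ψ∘ι`
  have h3 := finrank_fixedPoints_cmPrincipalSeries_stChar_integralLevel L v hns (ψ.comp ι)
  -- H2 at `K_v` (which contains the `d(1,b,1)`)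
  have hKv : ∀ b : ↥(normOneUnits (conjLocal L (IsCMField.complexConj L) v)), ∀ g : Gqs L v,
      (g.val.val : Matrix (Fin 3) (Fin 3) (LocalRing L v)) = Matrix.diagonal ![(1 : LocalRing L v), ((b : (LocalRing L v)ˣ) : LocalRing L v), 1] →
        g ∈ cmLocalIntegralLevel L 3 (qsForm L) v := by
    intro b g hg
    obtain ⟨t, ht, htK⟩ := exists_torus_diag_one_one L v hns b
    have htmat : ((t : ↥(unitaryGroupOfForm (conjLocal L (IsCMField.complexConj L) v) (cmLocalForm L 3 v))).val.val :
        Matrix (Fin 3) (Fin 3) (LocalRing L v)) = Matrix.diagonal ![(1 : LocalRing L v), ((b : (LocalRing L v)ˣ) : LocalRing L v), 1] := by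
      have htval : (t : ↥(unitaryGroupOfForm (conjLocal L (IsCMField.complexConj L) v) (cmLocalForm L 3 v))).val =
          glDiagonal 3 (LocalRing L v) ![(1 : (LocalRing L v)ˣ), (b : (LocalRing L v)ˣ), 1] := ht.symm
      rw [htval, coe_glDiagonal]
      congr 1
      funext k
      fin_cases k <;> rfl
    have heq : g = (t : ↥(unitaryGroupOfForm (conjLocal L (IsCMField.complexConj L) v) (cmLocalForm L 3 v))) := by
      apply Subtype.ext; apply Units.ext
      rw [htmat]
      exact hg
    rw [heq]
    exact htK
  have h2 := comp_detZ_eq_one_on_iff L v hns ι hι detZ hdetZ (cmLocalIntegralLevel L 3 (qsForm L) v) hKv ψ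
  -- `ψ∘ι = 1 ↔ ψ = 1`
  have hιψ : ψ.comp ι = 1 ↔ ψ = 1 := by
    constructor
    · intro h
      refine MonoidHom.ext fun c => ?_
      obtain ⟨z, rfl⟩ := F0P3cStCharTSStJH.surjective_of_pin L v hns ι hι c
      rw [← MonoidHom.comp_apply, h, MonoidHom.one_apply, MonoidHom.one_apply]
    · intro h
      rw [h, MonoidHom.one_comp]
  have h2' : (∀ k ∈ cmLocalIntegralLevel L 3 (qsForm L) v, (ψ.comp detZ) k = 1) ↔ ψ = 1 := by
    simp only [MonoidHom.comp_apply]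
    exact h2
  rw [h1, h3]
  by_cases hψ1 : ψ = 1
  · rw [if_pos (hιψ.2 hψ1), if_pos (h2'.2 hψ1)]
  · rw [if_neg (fun h => hψ1 (hιψ.1 h)), if_neg (fun h => hψ1 (h2'.1 h))]

set_option maxHeartbeats 1600000 in
set_option synthInstance.maxHeartbeats 400000 in
-- instance-path unification between `Gqs L v` and the literal carrier of ★ `cmPrincipalSeries`
/-- **HEAD (G6)-ST @ `K_v`: `St_G(ψ)` HAS NO `K_v`-SPHERICAL VECTOR.**  Over the ST-PIN package (READ), every representative of `St_G(ψ)` (every continuous `ψ`) has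
`K_v`-fixed vectors `= ⊥`: the rank is `0` (`finrank_fixedPoints_st_integralLevel_eq_zero`) and `St_G(ψ)` is admissible (a constituent of the admissible
`i_G(χ_St(ψ∘ι))`, ★ `isAdmissible_of_isConstituentOf`), so the `K_v`-fixed space is finite-dimensional and `dim = 0 ⇒ ⊥`.  In the EP currency:
the `K_v`-term of `Tr St_G(ψ)(f_EP^G)` vanishes. [cite: Rogawski1990, §12.2 (1) p. 173; §12.6 p. 188] [cite: Borel1976, §3–§4] [cite: Casselman1995, §3] -/
theorem st_fixedPoints_integralLevel_eq_bot (hns : ∀ w : PlacesOver L v, IsCMField.complexConj L • w.1 = w.1)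
    (ι : ↥(normOneUnits (conjLocal L (IsCMField.complexConj L) v)) →* ↥(Subgroup.center (Gqs L v))) (hιc : Continuous ι)
    (hι : ∀ z : ↥(normOneUnits (conjLocal L (IsCMField.complexConj L) v)),
      ((ι z).val.val.val : Matrix (Fin 3) (Fin 3) (LocalRing L v)) = (((z : (LocalRing L v)ˣ) : LocalRing L v)) • (1 : Matrix (Fin 3) (Fin 3) (LocalRing L v)))
    (detZ : Gqs L v →* ↥(Subgroup.center (Gqs L v)))
    (hdetZ : ∀ g : Gqs L v, ((detZ g).val.val.val : Matrix (Fin 3) (Fin 3) (LocalRing L v)) =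
        (g.val.val : Matrix (Fin 3) (Fin 3) (LocalRing L v)).det • (1 : Matrix (Fin 3) (Fin 3) (LocalRing L v)))
    (stG detG : (↥(Subgroup.center (Gqs L v)) →* ℂˣ) → IrrClass (Gqs L v))
    (ψ : ↥(Subgroup.center (Gqs L v)) →* ℂˣ) (hψ : Continuous ψ)
    (hopen : IsOpen (((ψ.comp detZ).ker : Subgroup (Gqs L v)) : Set (Gqs L v)))
    (hdet : detG ψ = IrrClass.mk (SmoothIrrep.ofChar (ψ.comp detZ) hopen))
    (hne : stG ψ ≠ detG ψ)
    (hJH : ∀ c : IrrClass (Gqs L v),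
      c.IsConstituentOf (cmPrincipalSeries L 3 v
        (cmTorusCharPair L v (halfModulusChar (LocalRing L v) * halfModulusChar (LocalRing L v))⁻¹ (ψ.comp ι))) ↔ (c = stG ψ ∨ c = detG ψ))
    (r : SmoothIrrep (Gqs L v)) (hr : IrrClass.mk r = stG ψ) :
    r.ρ.fixedPoints (cmLocalIntegralLevel L 3 (qsForm L) v) = ⊥ := by
  have hK := isCompact_isOpen_cmLocalIntegralLevel L 3 (qsForm L) v
  have h0 := finrank_fixedPoints_st_integralLevel_eq_zero L v hns ι hιc hι detZ hdetZ stG detG ψ hψ hopen hdet hne hJH r hr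
  -- `St_G(ψ)` is admissible: a constituent of the admissible principal series
  have hadmPS := F0P3XiUnramNonsplitInstance.isAdmissible_cmPrincipalSeries L v
    (cmTorusCharPair L v (halfModulusChar (LocalRing L v) * halfModulusChar (LocalRing L v))⁻¹ (ψ.comp ι))
  have hadm : (stG ψ).IsAdmissible := isAdmissible_of_isConstituentOf ((hJH (stG ψ)).2 (Or.inl rfl)) hadmPS
  rw [← hr, IrrClass.isAdmissible_mk] at hadm
  haveI : Module.Finite ℂ (r.ρ.fixedPoints (cmLocalIntegralLevel L 3 (qsForm L) v)) := hadm.2 ⟨_, hK.2⟩ hK.1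
  exact Submodule.finrank_eq_zero.1 h0

end Summit.HodgeConjecture.HodgeConjecture.Cruxes.H413.F0P3cStCharTSStNoSpherical

end
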